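import Summits.KontsevichZagierPeriods.KontsevichZagierPeriods.Theorems.SoloInformedCornerInduction
import Summits.KontsevichZagierPeriods.KontsevichZagierPeriods.Theorems.SoloInformedAlgPderiv
import HarnessLib

/-!
# Corner charts: transporting a corner configuration to a quadrant at an algebraic point

Solo programme `solo-KontsevichZagierPeriods-informed`, session s111, kernel project PRES-RAT(2),
step (δ-1).  The vertex recursion (THEOREM CORNER, file `SoloInformedCornerInduction`) decides
corner configurations on the unit square with the special point at the origin.  This file moves
it to an arbitrary open box `B = p + diag(β) · (0,1)²` with a vertex at a `K`-point `p`
(`K ⊆ ℚ̄ ∩ ℝ`): the diagonal affine chart `Φ(z) = p + diag(β) z`, its Jacobian `β₀ β₁`, the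
substitution `Q ↦ Q ∘ Φ` on `K[x₀, x₁]` with its chain rule, and **THEOREM QUADRANT**
(`soloInformed_presOn_inter_quadrant`): if `Ω` is open and `ℚ`-semialgebraic with
`frontier Ω ⊆ Z(F)`, `Sing F` is finite, and every point of `Φ([0,1]² ∖ {0}) ∩ closure Ω ∩ Z(F)`
is a smooth point of `Z(F)` off `Z(D)`, then presentability of the pulled-back corner
configuration gives presentability of `P/D` on `Ω ∩ B` (KZ rule (2) for `Φ`).

References: Kontsevich–Zagier, *Periods* (2001), §1.2.
-/

noncomputable section

open scoped BigOperators Topology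
open MeasureTheory Set Filter Metric
open Literature.NumberTheory.Transcendental Literature.NumberTheory.Transcendental.KZ
open Literature.ModelTheory.ExponentialFields (IsSemialgebraic)

namespace Summit.KontsevichZagierPeriods.KontsevichZagierPeriods.Theorems

variable {K : Type*} [Field K] [Algebra K ℝ]

/-! ### The diagonal affine chart -/

/-- The diagonal affine chart `Φ_{α,β}(z)_i = α_i + β_i z_i`. [this work] -/
def soloInformedDiagMoveR (α β : Fin 2 → ℝ) (z : Fin 2 → ℝ) : Fin 2 → ℝ :=
  fun i => α i + β i * z i

/-- Components of the chart. -/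
@[simp] theorem soloInformedDiagMoveR_apply (α β : Fin 2 → ℝ) (z : Fin 2 → ℝ) (i : Fin 2) :
    soloInformedDiagMoveR α β z i = α i + β i * z i := rfl

/-- The chart sends the origin to `α`. -/
theorem soloInformedDiagMoveR_zero (α β : Fin 2 → ℝ) : soloInformedDiagMoveR α β 0 = α := by
  funext i; simp

/-- The (constant) derivative `diag(β)` of the chart. [this work] -/
def soloInformedDiagDerivR (β : Fin 2 → ℝ) : (Fin 2 → ℝ) →L[ℝ] (Fin 2 → ℝ) :=
  LinearMap.toContinuousLinearMap (Matrix.toLin' (Matrix.diagonal β))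

/-- The derivative applied to a vector. -/
theorem soloInformedDiagDerivR_apply (β v : Fin 2 → ℝ) (i : Fin 2) :
    soloInformedDiagDerivR β v i = β i * v i := by
  simp [soloInformedDiagDerivR, Matrix.toLin'_apply, Matrix.mulVec_diagonal]

/-- **The Jacobian determinant is `β₀ β₁`.** -/
theorem soloInformed_det_diagDerivR (β : Fin 2 → ℝ) :
    (soloInformedDiagDerivR β).det = β 0 * β 1 := by
  simp only [soloInformedDiagDerivR, ContinuousLinearMap.det, LinearMap.coe_toContinuousLinearMap,
    LinearMap.det_toLin', Matrix.det_diagonal, Fin.prod_univ_two]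

/-- Differentiability of the chart. -/
theorem soloInformed_hasFDerivAt_diagMoveR (α β z : Fin 2 → ℝ) :
    HasFDerivAt (soloInformedDiagMoveR α β) (soloInformedDiagDerivR β) z := by
  refine hasFDerivAt_pi'' fun i => ?_
  have h := ((hasFDerivAt_apply (𝕜 := ℝ) i z).const_mul (β i)).const_add (α i)
  refine h.congr_fderiv ?_
  ext v
  simp [soloInformedDiagDerivR_apply]

/-- The chart is continuous. -/
theorem soloInformed_continuous_diagMoveR (α β : Fin 2 → ℝ) :
    Continuous (soloInformedDiagMoveR α β) :=
  continuous_pi fun i => continuous_const.add (continuous_const.mul (continuous_apply i))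

/-- The chart is injective when no `β_i` vanishes. -/
theorem soloInformed_diagMoveR_injective {α β : Fin 2 → ℝ} (hβ : ∀ i, β i ≠ 0) :
    Function.Injective (soloInformedDiagMoveR α β) := fun x y h => by
  funext i
  have hi := congr_fun h i
  simp only [soloInformedDiagMoveR_apply, add_right_inj] at hi
  exact mul_left_cancel₀ (hβ i) hi

/-- **The image of the open square** is the open box with opposite vertices `α`, `α + β`. -/
theorem soloInformed_diagMoveR_image_openCube {α β : Fin 2 → ℝ} (hβ : ∀ i, β i ≠ 0) :
    soloInformedDiagMoveR α β '' soloInformedOpenCube 2 =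
      {w | ∀ i, 0 < (w i - α i) / β i ∧ (w i - α i) / β i < 1} := by
  ext w
  constructor
  · rintro ⟨z, hz, rfl⟩ i
    have h : (α i + β i * z i - α i) / β i = z i := by field_simp [hβ i]; ring
    simp only [soloInformedDiagMoveR_apply, h]
    exact hz i
  · intro hw
    refine ⟨fun i => (w i - α i) / β i, fun i => hw i, funext fun i => ?_⟩
    simp only [soloInformedDiagMoveR_apply]
    field_simp [hβ i]
    ring

/-! ### The substitution on `K[x₀, x₁]` -/

/-- The coordinate polynomials `a_j + b_j x_j` of the chart. [this work] -/
def soloInformedDiagPolyK (a b : Fin 2 → K) (j : Fin 2) : MvPolynomial (Fin 2) K :=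
  MvPolynomial.C (a j) + MvPolynomial.C (b j) * MvPolynomial.X j

/-- Evaluating the coordinate polynomials. -/
theorem soloInformed_aeval_diagPolyK (a b : Fin 2 → K) (z : Fin 2 → ℝ) (j : Fin 2) :
    (MvPolynomial.aeval z (soloInformedDiagPolyK a b j) : ℝ) =
      algebraMap K ℝ (a j) + algebraMap K ℝ (b j) * z j := by
  simp [soloInformedDiagPolyK]

/-- The chart with parameters in `K` is a `K`-polynomial map. -/
theorem soloInformed_diagMoveR_eq_aeval (a b : Fin 2 → K) (z : Fin 2 → ℝ) :
    soloInformedDiagMoveR (fun i => algebraMap K ℝ (a i)) (fun i => algebraMap K ℝ (b i)) z =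
      fun j => (MvPolynomial.aeval z (soloInformedDiagPolyK a b j) : ℝ) :=
  funext fun j => (soloInformed_aeval_diagPolyK a b z j).symm

/-- **The substitution `Q ↦ Q ∘ Φ_{a,b}`.** [this work] -/
def soloInformedDiagSubstK (a b : Fin 2 → K) :
    MvPolynomial (Fin 2) K →ₐ[K] MvPolynomial (Fin 2) K :=
  MvPolynomial.bind₁ (soloInformedDiagPolyK a b)

/-- Evaluating the substituted polynomial is evaluating at the moved point. -/
theorem soloInformed_aeval_diagSubstK (a b : Fin 2 → K) (z : Fin 2 → ℝ)
    (Q : MvPolynomial (Fin 2) K) :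
    (MvPolynomial.aeval z (soloInformedDiagSubstK a b Q) : ℝ) =
      MvPolynomial.aeval (soloInformedDiagMoveR (fun i => algebraMap K ℝ (a i))
        (fun i => algebraMap K ℝ (b i)) z) Q := by
  unfold soloInformedDiagSubstK
  rw [MvPolynomial.aeval_bind₁, soloInformed_diagMoveR_eq_aeval]

omit [Algebra K ℝ] in
/-- Partial derivatives of the coordinate polynomials. -/
theorem soloInformed_pderiv_diagPolyK (a b : Fin 2 → K) (i j : Fin 2) :
    MvPolynomial.pderiv i (soloInformedDiagPolyK a b j) =
      if j = i then MvPolynomial.C (b j) else 0 := by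
  by_cases h : j = i
  · subst h
    simp [soloInformedDiagPolyK]
  · simp [soloInformedDiagPolyK, h]

omit [Algebra K ℝ] in
/-- **Chain rule**: `∂_i (Q ∘ Φ) = b_i · (∂_i Q) ∘ Φ`. -/
theorem soloInformed_pderiv_diagSubstK (a b : Fin 2 → K) (i : Fin 2)
    (Q : MvPolynomial (Fin 2) K) :
    MvPolynomial.pderiv i (soloInformedDiagSubstK a b Q) =
      MvPolynomial.C (b i) * soloInformedDiagSubstK a b (MvPolynomial.pderiv i Q) := by
  unfold soloInformedDiagSubstK
  rw [soloInformed_pderiv_bind₁, soloInformed_pderiv_diagPolyK, soloInformed_pderiv_diagPolyK]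
  fin_cases i
  · simp [mul_comm]
  · simp [mul_comm]

/-- Evaluating a partial derivative of the substituted polynomial. -/
theorem soloInformed_aeval_pderiv_diagSubstK (a b : Fin 2 → K) (i : Fin 2) (z : Fin 2 → ℝ)
    (Q : MvPolynomial (Fin 2) K) :
    (MvPolynomial.aeval z (MvPolynomial.pderiv i (soloInformedDiagSubstK a b Q)) : ℝ) =
      algebraMap K ℝ (b i) * MvPolynomial.aeval (soloInformedDiagMoveR
        (fun i => algebraMap K ℝ (a i)) (fun i => algebraMap K ℝ (b i)) z)
          (MvPolynomial.pderiv i Q) := by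
  rw [soloInformed_pderiv_diagSubstK, map_mul, MvPolynomial.aeval_C, soloInformed_aeval_diagSubstK]

/-- The singular set of the substituted polynomial lies over the singular set. -/
theorem soloInformed_singSet_diagSubstK_subset (a b : Fin 2 → K)
    (hb : ∀ i, algebraMap K ℝ (b i) ≠ 0) (F : MvPolynomial (Fin 2) K) :
    soloInformedSingSet (soloInformedDiagSubstK a b F) ⊆
      (fun q : ℝ × ℝ => (algebraMap K ℝ (a 0) + algebraMap K ℝ (b 0) * q.1,
        algebraMap K ℝ (a 1) + algebraMap K ℝ (b 1) * q.2)) ⁻¹' soloInformedSingSet F := by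
  intro q hq
  rw [soloInformed_mem_singSet] at hq
  obtain ⟨h0, h1, h2⟩ := hq
  have hΦ : soloInformedDiagMoveR (fun i => algebraMap K ℝ (a i)) (fun i => algebraMap K ℝ (b i))
      ![q.1, q.2] = ![algebraMap K ℝ (a 0) + algebraMap K ℝ (b 0) * q.1,
        algebraMap K ℝ (a 1) + algebraMap K ℝ (b 1) * q.2] := by
    funext i; fin_cases i <;> rfl
  rw [soloInformed_evalR_apply, soloInformed_aeval_diagSubstK, hΦ] at h0
  rw [soloInformed_evalR_apply, soloInformed_aeval_pderiv_diagSubstK, hΦ] at h1 h2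
  rw [mem_preimage, soloInformed_mem_singSet, soloInformed_evalR_apply, soloInformed_evalR_apply,
    soloInformed_evalR_apply]
  exact ⟨h0, (mul_eq_zero.1 h1).resolve_left (hb 0), (mul_eq_zero.1 h2).resolve_left (hb 1)⟩

/-- Hence it is finite if the singular set is. -/
theorem soloInformed_singSet_diagSubstK_finite (a b : Fin 2 → K)
    (hb : ∀ i, algebraMap K ℝ (b i) ≠ 0) {F : MvPolynomial (Fin 2) K}
    (hF : (soloInformedSingSet F).Finite) :
    (soloInformedSingSet (soloInformedDiagSubstK a b F)).Finite := by
  refine (hF.preimage fun p _ q _ hpq => ?_).subset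
    (soloInformed_singSet_diagSubstK_subset a b hb F)
  simp only [Prod.mk.injEq, add_right_inj] at hpq
  exact Prod.ext (mul_left_cancel₀ (hb 0) hpq.1) (mul_left_cancel₀ (hb 1) hpq.2)

/-! ### THEOREM QUADRANT -/

section Quadrant

variable [CharZero K]

/-- **THEOREM QUADRANT.**  Let `K ⊆ ℚ̄ ∩ ℝ` be real-root closed, `Ω` open and
`ℚ`-semialgebraic with `frontier Ω ⊆ Z(F)` and `Sing F` finite, and let
`Φ(z) = a + diag(b) z` (`a, b ∈ K²`, `b₀ b₁ ≠ 0`) be a chart such that at every point of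
`Φ([0,1]² ∖ {0}) ∩ closure Ω ∩ Z(F)` the curve `Z(F)` is smooth and `D ≠ 0`.  Then `P/D` is
presentable on `Ω ∩ Φ((0,1)²)`: the pulled-back data form a corner configuration, decided by
THEOREM CORNER, and KZ rule (2) for `Φ` (Jacobian `|b₀ b₁|`) transports the presentation.
[this work] -/
theorem soloInformed_presOn_inter_quadrant (hK : ∀ c : K, IsAlgebraic ℚ (algebraMap K ℝ c))
    (hKrc : SoloInformedRealRootClosed K) {F D : MvPolynomial (Fin 2) K} {Ω : Set (Fin 2 → ℝ)}
    (hΩo : IsOpen Ω) (hΩ : IsSemialgebraic ℚ Ω)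
    (hfr : ∀ z ∈ frontier Ω, (MvPolynomial.aeval z F : ℝ) = 0)
    (hsing : (soloInformedSingSet F).Finite) (a b : Fin 2 → K)
    (hb : ∀ i, algebraMap K ℝ (b i) ≠ 0)
    (hgood : ∀ z ∈ soloInformedCube 2, z ≠ 0 →
      soloInformedDiagMoveR (fun i => algebraMap K ℝ (a i)) (fun i => algebraMap K ℝ (b i)) z ∈
        closure Ω →
      (MvPolynomial.aeval (soloInformedDiagMoveR (fun i => algebraMap K ℝ (a i))
        (fun i => algebraMap K ℝ (b i)) z) F : ℝ) = 0 →
      ((MvPolynomial.aeval (soloInformedDiagMoveR (fun i => algebraMap K ℝ (a i))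
          (fun i => algebraMap K ℝ (b i)) z) (MvPolynomial.pderiv 0 F) : ℝ) ≠ 0 ∨
        (MvPolynomial.aeval (soloInformedDiagMoveR (fun i => algebraMap K ℝ (a i))
          (fun i => algebraMap K ℝ (b i)) z) (MvPolynomial.pderiv 1 F) : ℝ) ≠ 0) ∧
      (MvPolynomial.aeval (soloInformedDiagMoveR (fun i => algebraMap K ℝ (a i))
        (fun i => algebraMap K ℝ (b i)) z) D : ℝ) ≠ 0)
    (P : MvPolynomial (Fin 2) K) :
    SoloInformedPresOn (Ω ∩ soloInformedDiagMoveR (fun i => algebraMap K ℝ (a i))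
        (fun i => algebraMap K ℝ (b i)) '' soloInformedOpenCube 2)
      (fun z => (MvPolynomial.aeval z P : ℝ) / MvPolynomial.aeval z D) := by
  set α : Fin 2 → ℝ := fun i => algebraMap K ℝ (a i) with hα
  set β : Fin 2 → ℝ := fun i => algebraMap K ℝ (b i) with hβ
  set Φ := soloInformedDiagMoveR α β with hΦ
  have hβ0 : ∀ i, β i ≠ 0 := hb
  have hcont : Continuous Φ := soloInformed_continuous_diagMoveR α β
  set S : Set (Fin 2 → ℝ) := {z | z ∈ soloInformedOpenCube 2 ∧ Φ z ∈ Ω} with hS_def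
  have hS : IsSemialgebraic ℚ S := by
    convert soloInformed_isSemialgebraic_sep_preimage hK (isSemialgebraic_soloInformedOpenCube 2)
      (soloInformedDiagPolyK a b) hΩ using 1
    ext z
    rw [mem_setOf_eq, mem_setOf_eq, hΦ, soloInformed_diagMoveR_eq_aeval]
  have hSo : IsOpen S := (soloInformed_isOpen_openCube 2).inter (hΩo.preimage hcont)
  have himg : Ω ∩ Φ '' soloInformedOpenCube 2 = Φ '' S := by
    ext w
    constructor
    · rintro ⟨hw, z, hz, rfl⟩
      exact ⟨z, ⟨hz, hw⟩, rfl⟩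
    · rintro ⟨z, ⟨hz, hw⟩, rfl⟩
      exact ⟨hw, z, hz, rfl⟩
  rw [himg]
  have hJ : IsSemialgebraicFunOn ℚ S fun _ : Fin 2 → ℝ => |(soloInformedDiagDerivR β).det| := by
    refine (isSemialgebraicFunOn_const_of_isAlgebraic hS
      (hK (soloInformedAbsK (b 0 * b 1)))).congr fun z _ => ?_
    rw [soloInformed_det_diagDerivR, soloInformed_algebraMap_absK, map_mul]
  refine soloInformed_presOn_image hS Φ (fun _ => soloInformedDiagDerivR β)
    (IsSemialgebraicMapOn.of_forall hS fun j =>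
      (soloInformed_isSemialgebraicFunOn_aevalK hK hS (soloInformedDiagPolyK a b j)).congr
        fun z _ => soloInformed_aeval_diagPolyK a b z j)
    (fun z _ => (soloInformed_hasFDerivAt_diagMoveR α β z).hasFDerivWithinAt)
    ((soloInformed_diagMoveR_injective hβ0).injOn) hJ ?_
  -- the pulled-back integrand is `P'' / D'` with `P'' = |b₀ b₁| · P ∘ Φ`, `D' = D ∘ Φ`
  set F' := soloInformedDiagSubstK a b F with hF'
  set D' := soloInformedDiagSubstK a b D with hD'
  set P'' := MvPolynomial.C (soloInformedAbsK (b 0 * b 1)) * soloInformedDiagSubstK a b P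
    with hP''
  have hfun : EqOn (fun z => (MvPolynomial.aeval z P'' : ℝ) / MvPolynomial.aeval z D')
      (fun z => (fun w => (MvPolynomial.aeval w P : ℝ) / MvPolynomial.aeval w D) (Φ z) *
        |(soloInformedDiagDerivR β).det|) S := by
    intro z _
    simp only [hP'', hD', map_mul, MvPolynomial.aeval_C, soloInformed_aeval_diagSubstK,
      soloInformed_det_diagDerivR, soloInformed_algebraMap_absK, map_mul]
    ring
  refine (soloInformed_presOn_congr hfun).1 (soloInformed_cornerOK hK hKrc F' D' S P'' ?_)
  refine ⟨hSo, hS, fun z hz => hz.1, ?_, ?_, soloInformed_singSet_diagSubstK_finite a b hb hsing⟩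
  · -- frontier invariant
    intro z hz hzfr
    rw [hF', soloInformed_aeval_diagSubstK]
    apply hfr
    have h1 : z ∈ frontier (Φ ⁻¹' Ω) := by
      rw [frontier, Set.mem_sdiff] at hzfr ⊢
      refine ⟨closure_mono (fun w hw => hw.2) hzfr.1, fun hint => hzfr.2 ?_⟩
      rw [show S = soloInformedOpenCube 2 ∩ Φ ⁻¹' Ω from rfl, interior_inter,
        (soloInformed_isOpen_openCube 2).interior_eq]
      exact ⟨hz, hint⟩
    exact hcont.frontier_preimage_subset Ω h1
  · -- the special point is the only bad point of the closed square
    intro z hz hz0 hzcl hFz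
    have hcl : Φ z ∈ closure Ω :=
      hcont.closure_preimage_subset Ω (closure_mono (fun w hw => hw.2) hzcl)
    rw [hF', soloInformed_aeval_diagSubstK] at hFz
    obtain ⟨hgrad, hD⟩ := hgood z hz hz0 hcl hFz
    refine ⟨?_, by rwa [hD', soloInformed_aeval_diagSubstK]⟩
    rw [hF', soloInformed_aeval_pderiv_diagSubstK, soloInformed_aeval_pderiv_diagSubstK]
    rcases hgrad with h | h
    · exact Or.inl (mul_ne_zero (hb 0) h)
    · exact Or.inr (mul_ne_zero (hb 1) h)

end Quadrant

end Summit.KontsevichZagierPeriods.KontsevichZagierPeriods.Theorems
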